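import Literature.NumberTheory.Automorphic.ReciprocityGLn
import Literature.NumberTheory.Automorphic.PairLFunctionPolesChangeOfS
import Literature.NumberTheory.Automorphic.LocalComponentGenericHolds
import Literature.NumberTheory.Automorphic.SatakeParameterGenericBoundHolds
import Literature.NumberTheory.Automorphic.AutomorphicRepsGLAssociatedL2Holds
import Literature.NumberTheory.Automorphic.AutomorphicRepsGLSatakeDictionaryHolds
import Literature.NumberTheory.Automorphic.LanglandsTetrahedralProofs
import HarnessLib

/-!
# The Satake gap `a ≠ q_v b` for cuspidal automorphic representations of `GL_n`

Helper file for the crux `GaloisRepOfRegularAlgebraic` (stmt-Langlands-10785), line `Sketch`,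
stub `stub_satakeGap` (S3).  For a cuspidal Borel–Jacquet datum `π` on `GL_n(𝔸_K)` and a finite
place `v` at which `π` has Satake parameter `α`, no two entries of `α` are in ratio `q_v`.

Proof (all inputs are theorems of the tree, axioms `propext`, `Classical.choice`, `Quot.sound`):

* `L²` side (`satakeGap_of_hasSatakeParameterAt`).  If a cuspidal `Π ≤ L²_cusp(GL_n(𝔸_K) ⧸ A_G GL_n(K))`
  has Hecke–Satake parameter `α` at `v` for a level `K(𝔫)`, `v ∤ 𝔫 ≠ 0`, then every `a ∈ α` has
  `|a| < q_v^{1/2}` — Jacquet–Shalika's Cor. (2.5) (`JacquetShalika1981_norm_lt_sqrt_of_isGeneric_holds`)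
  for the generic (`Shalika1974_isGeneric_of_hasLocalComponentAt_holds`), unitary, unramified local
  component (`exists_hasLocalComponentAt_holds`, `Flath1979_isSatakeParameter_of_hasLocalComponentAt_holds`),
  assembled by `norm_satakeParameter_lt_sqrt_of_isGeneric` — and `α` is stable under `a ↦ ā⁻¹`
  (unitarity, `HasSatakeParameterAt.map_conj_inv_eq`), whence also `|a| > q_v^{-1/2}`
  (`0 ∉ α` by `HasSatakeParameterAt.norm_prod_eq_one`); so `|a / b| < q_v`.
* Borel–Jacquet side (`stub_satakeGap`).  `n = 0` is vacuous (`card α = 0`).  For `n ≥ 1` pick an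
  automorphic measure (`AdelicGroupData.exists_isAutomorphicMeasure_gl_holds`), a clean model with the
  same Satake parameters (`CuspidalAutomorphicRepData.exists_clean_hasSatakeParamAt_iff_of_sSup_irreducible`,
  `AutomorphicRepsGL.stable_cuspidal_eq_sSup_irreducible_holds`) and its unitary normalisation in `L²`
  keeping the dictionary at EVERY place (`CuspidalAutomorphicRepData.exists_satake_eq_cpow_mul_L2_pointwise`
  with `AutomorphicRepsGL.exists_isAssociatedL2_holds`, `hasSatakeParamAt_iff_L2_holds`): `q_v^{-s} α`
  is an `L²` Hecke–Satake parameter of a cuspidal `Π` at `v`, and the ratio condition is invariant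
  under the common scalar `q_v^{-s}`.
-/

noncomputable section

set_option linter.dupNamespace false -- project-wide option (lakefile weak.linter.dupNamespace); `Summit.Langlands.Langlands` is the mandated namespace

open scoped NumberField
open NumberField IsDedekindDomain MeasureTheory Literature.NumberTheory.Automorphic

namespace Summit.Langlands.Langlands.Theorems.GaloisRepOfRegularAlgebraic

/-- **The Satake gap in the `L²` model.**  If a cuspidal `Π ≤ L²_cusp(GL_n(𝔸_K) ⧸ A_G GL_n(K), μ)`
has Hecke–Satake parameter `α` at `v` with respect to a principal congruence level `K(𝔫)`,
`v ∤ 𝔫 ≠ 0`, then `a ≠ q_v b` for all `a, b ∈ α`: by Jacquet–Shalika's Cor. (2.5) every entry has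
`|a| < q_v^{1/2}` (`norm_satakeParameter_lt_sqrt_of_isGeneric`, all four inputs discharged in the
tree), and `α` is stable under `a ↦ ā⁻¹` (`HasSatakeParameterAt.map_conj_inv_eq`, unitarity of the
right regular representation) with `0 ∉ α` (`|∏ α| = 1`), so also `|b| > q_v^{-1/2}` and
`|a| < q_v |b|`. [cite: JacquetShalikaAJM1981, Cor. (2.5) p. 515] -/
theorem satakeGap_of_hasSatakeParameterAt {n : ℕ} {K : Type} [Field K] [NumberField K]
    {μ : Measure (AdelicGroupData.gl n K).automorphicQuotient}
    [(AdelicGroupData.gl n K).IsAutomorphicMeasure μ]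
    (P : CuspidalAutomorphicRepGL n K μ) {v : HeightOneSpectrum (𝓞 K)} {𝔫 : Ideal (𝓞 K)}
    (h𝔫 : 𝔫 ≠ 0) (hv : ¬ v.asIdeal ∣ 𝔫) {ϖ : (v.adicCompletion K)ˣ} {α : Multiset ℂ}
    (hα : HasSatakeParameterAt P.1 (principalCongruenceLevel n K 𝔫) v ϖ α) :
    ∀ a ∈ α, ∀ b ∈ α, a ≠ (v.residueCard : ℂ) * b := by
  -- Jacquet–Shalika's strict bound at `v`, through the one-place Satake family `w ↦ α` off `{w ≠ v}`
  have hfam : IsSatakeFamilyOf P {w | w ≠ v} (fun _ => α) := by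
    intro w hw
    have hwv : w = v := by
      by_contra h
      exact hw h
    subst hwv
    exact ⟨𝔫, h𝔫, hv, ϖ, hα⟩
  have hlt : ∀ a ∈ α, ‖a‖ < Real.sqrt v.residueCard := fun a ha =>
    norm_satakeParameter_lt_sqrt_of_isGeneric exists_hasLocalComponentAt_holds
      Flath1979_isSatakeParameter_of_hasLocalComponentAt_holds
      Shalika1974_isGeneric_of_hasLocalComponentAt_holds
      (fun _ _ _ _ _ => JacquetShalika1981_norm_lt_sqrt_of_isGeneric_holds) P hfam
      (fun h => h rfl) ha
  -- unitarity of the unramified local component, and `0 ∉ α`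
  have hconj : α.map (fun a => (starRingEnd ℂ a)⁻¹) = α := hα.map_conj_inv_eq h𝔫 hv
  have hprod : ‖α.prod‖ = 1 := hα.norm_prod_eq_one
  intro a ha b hb hab
  have hb0 : b ≠ 0 := by
    rintro rfl
    rw [Multiset.prod_eq_zero hb, norm_zero] at hprod
    exact zero_ne_one hprod
  have hc : (starRingEnd ℂ b)⁻¹ ∈ α := by
    have h := Multiset.mem_map_of_mem (fun a => (starRingEnd ℂ a)⁻¹) hb
    rwa [hconj] at h
  -- `‖b‖⁻¹ < √q` and `q ‖b‖ = ‖a‖ < √q`: absurd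
  have h1 := hlt _ hc
  have h2 := hlt a ha
  rw [norm_inv, Complex.norm_conj] at h1
  rw [hab, norm_mul, Complex.norm_natCast] at h2
  have hq : (0 : ℝ) < v.residueCard := by
    exact_mod_cast lt_trans zero_lt_one v.one_lt_residueCard
  have hs : 0 < Real.sqrt v.residueCard := Real.sqrt_pos.mpr hq
  have hsq : Real.sqrt v.residueCard * Real.sqrt v.residueCard = v.residueCard :=
    Real.mul_self_sqrt hq.le
  have hbpos : 0 < ‖b‖ := norm_pos_iff.mpr hb0
  have h1' : 1 < Real.sqrt v.residueCard * ‖b‖ := by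
    have h := mul_lt_mul_of_pos_right h1 hbpos
    rwa [inv_mul_cancel₀ hbpos.ne'] at h
  have h2' : Real.sqrt v.residueCard * ‖b‖ < 1 := by
    refine lt_of_not_ge fun h => ?_
    have h3 : Real.sqrt v.residueCard ≤ (v.residueCard : ℝ) * ‖b‖ :=
      calc Real.sqrt v.residueCard = Real.sqrt v.residueCard * 1 := (mul_one _).symm
        _ ≤ Real.sqrt v.residueCard * (Real.sqrt v.residueCard * ‖b‖) :=
          mul_le_mul_of_nonneg_left h hs.le
        _ = (v.residueCard : ℝ) * ‖b‖ := by rw [← mul_assoc, hsq]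
    exact absurd (h3.trans_lt h2) (lt_irrefl _)
  exact absurd (h1'.trans h2') (lt_irrefl _)

/-- **The Satake gap (S3 of line `Sketch`, crux `GaloisRepOfRegularAlgebraic`).**  For `K` totally
real or CM and `π` a regular algebraic cuspidal automorphic representation of `GL_n(𝔸_K)`
(Borel–Jacquet datum), at every finite place `v` where `π` has Satake parameter `α`, no two entries
of `α` are in ratio `q_v`: `a ≠ q_v b`.  (Neither the hypothesis on `K` nor regularity is used.)
`n = 0`: `α = 0`.  `n ≥ 1`: realise a clean model of `π` with the same Satake parameters, twisted to be
`A_G`-invariant, inside `L²_cusp` keeping the Satake dictionary at every place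
(`CuspidalAutomorphicRepData.exists_satake_eq_cpow_mul_L2_pointwise`, fed with the theorems
`AutomorphicRepsGL.exists_isAssociatedL2_holds`, `hasSatakeParamAt_iff_L2_holds`,
`AutomorphicRepsGL.stable_cuspidal_eq_sSup_irreducible_holds`,
`AdelicGroupData.exists_isAutomorphicMeasure_gl_holds`); then `q_v^{-s} α` is an `L²` Hecke–Satake
parameter at `v` and `satakeGap_of_hasSatakeParameterAt` (Jacquet–Shalika Cor. (2.5) + unitarity)
applies, the ratio condition being invariant under the common factor `q_v^{-s}`.
[cite: JacquetShalikaAJM1981, Cor. (2.5) p. 515] -/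
theorem stub_satakeGap :
    ∀ {n : ℕ} {K : Type} [Field K] [NumberField K] (hcpt : isCompact_glFiniteIntegralLevel n K),
      IsTotallyReal K ∨ IsCMField K →
      ∀ (π : CuspidalAutomorphicRepData n K hcpt), π.1.IsRegularAlgebraic →
      ∀ (v : HeightOneSpectrum (𝓞 K)) (α : Multiset ℂ), π.1.HasSatakeParamAt v α →
        ∀ a ∈ α, ∀ b ∈ α, a ≠ (v.residueCard : ℂ) * b := by
  intro n K _ _ hcpt _ π _ v α hα
  rcases Nat.eq_zero_or_pos n with hn | hn
  · subst hn
    have h0 : α = 0 := Multiset.card_eq_zero.mp hα.card_eq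
    subst h0
    intro a ha
    exact absurd ha (Multiset.notMem_zero a)
  haveI : NeZero n := ⟨hn.ne'⟩
  obtain ⟨μ, hμ⟩ := AdelicGroupData.exists_isAutomorphicMeasure_gl_holds n K
  haveI := hμ
  obtain ⟨π₀, h0W', h0π⟩ :=
    CuspidalAutomorphicRepData.exists_clean_hasSatakeParamAt_iff_of_sSup_irreducible
      (AutomorphicRepsGL.stable_cuspidal_eq_sSup_irreducible_holds (hcpt := hcpt)) π
  obtain ⟨s, P, _S, _αP, -, -, -, hdict⟩ :=
    CuspidalAutomorphicRepData.exists_satake_eq_cpow_mul_L2_pointwise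
      (AutomorphicRepsGL.exists_isAssociatedL2_holds hcpt μ) (hasSatakeParamAt_iff_L2_holds hcpt μ)
      π π₀ h0W' h0π
  obtain ⟨𝔫, ϖ, h𝔫, hv𝔫, hSat⟩ := (hdict v α).1 hα
  have hgap := satakeGap_of_hasSatakeParameterAt P h𝔫 hv𝔫 hSat
  intro a ha b hb hab
  refine hgap _ (Multiset.mem_map_of_mem _ ha) _ (Multiset.mem_map_of_mem _ hb) ?_
  rw [hab]
  ring

end Summit.Langlands.Langlands.Theorems.GaloisRepOfRegularAlgebraic

end
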